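import Literature.NumberTheory.ComplexMultiplication.ReflexFieldOfDefinition
import Literature.AlgebraicGeometry.Milne1999.TateFromCodesHCOfHSimplePos
import Literature.AlgebraicGeometry.Motives.AbelianVarietyCohomologyExteriorH1
import HarnessLib

/-!
# The junction predicate `HasRationalInvariantForms` holds on the trivial abelian variety

Family `hodge`, lane `lit-hodgefound` (Layer A3 / B6 junction; queue row Q57 = TRIBUNAL-B v3 sanity
demand V-B22 on row B38), topic `Literature/NumberTheory/ComplexMultiplication`.

`Literature.NumberTheory.ComplexMultiplication.HasRationalInvariantForms A₀`
(`ReflexFieldOfDefinition`, Shimura 1998 §2.6 Prop. 3 with §2.8: "`𝔇₀(G; k)` is a vector space of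
dimension `n` over `k`; and we have `𝔇₀(G) = 𝔇₀(G; k) ⊗_k Ω`", read on `H^{1,0}`) is a
PREDICATE on an abelian variety `A₀` over a field `k ⊆ ℂ`: the `(1,0)`-classes of
`H¹((A₀ ⊗_k ℂ)(ℂ); ℂ)` admit a basis in which every `k`-endomorphism acts through a matrix with
coefficients in `k`.  TRIBUNAL-B v3 (row B38, demand V-B22) asked for the sanity instance that this
predicate is INHABITED in the tree: it holds for the trivial abelian variety `0 = Spec k`
(`Motives.AbelianVariety.trivial k`), with `n = 0` and the empty family of forms — Shimura's `n` is
the dimension of `G` (§2.6 Prop. 3: "Let `G` be a group variety of dimension `n` … `𝔇₀(G; k)` is a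
vector space of dimension `n` over `k`"), here `0`.

Proof (all inputs are theorems of the tree): `dim (0 ⊗_k ℂ) = dim 0 = 0`
(`AbelianVariety.dim_baseChange`, `AbelianVariety.dim_trivial`), so
`b₁((0 ⊗_k ℂ)(ℂ)) = 2 · 0 = 0` (`AbelianVariety.finrank_complexBetti_one`, Mumford §1 (3)) and
`H¹((0 ⊗_k ℂ)(ℂ); ℂ) = 0` (it is finite-dimensional, `abelianVarietyCohomologyExteriorH1_holds`);
hence there are no non-zero `(1,0)`-classes and the empty family `ω : Fin 0 → H¹` is a basis of
them, on which the (empty) matrix condition is vacuous.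

This is a SANITY instance only (non-vacuity of the typed predicate); the genuine instances
(every `A₀/k`: GAGA + flat base change + Dolbeault) are the lane's programme row Q40.
Theorem only; no definition, no named fact (D-0026: net Literature debt 0).

## Main statements

* `subsingleton_complexBetti_one_trivial_baseChange` — `H¹((0 ⊗_k ℂ)(ℂ); ℂ) = 0`.
* `hasRationalInvariantForms_trivial` — **V-B22**: `HasRationalInvariantForms (AbelianVariety.trivial k)`.

## References

* [Shimura1998] G. Shimura, *Abelian Varieties with Complex Multiplication and Modular Functions*,
  Princeton Univ. Press 1998, §2.6 Prop. 3 (p. 20), §2.8 (pp. 23, 27).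
* [MumfordAV1970] D. Mumford, *Abelian Varieties* (1970), §1 (3)–(4) (`b₁ = 2g`).
-/

noncomputable section

open Literature.AlgebraicGeometry
open Literature.AlgebraicGeometry.Motives (AbelianVariety)
open Literature.AlgebraicGeometry.HodgeTheory (complexBetti)

namespace Literature.NumberTheory.ComplexMultiplication

variable (k : Type) [Field k] [Algebra k ℂ]

/-- **`H¹((0 ⊗_k ℂ)(ℂ); ℂ) = 0`** for the trivial abelian variety `0 = Spec k`: its base change to
`ℂ` has dimension `dim 0 = 0` (`dim_baseChange`, `dim_trivial`), so `b₁ = 2 · 0 = 0`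
(`AbelianVariety.finrank_complexBetti_one`) and the finite-dimensional `H¹` vanishes.
[cite: MumfordAV1970, §1 (3)–(4)] -/
theorem subsingleton_complexBetti_one_trivial_baseChange :
    Subsingleton (complexBetti ((AbelianVariety.trivial k).baseChange ℂ).X 1) := by
  haveI : Module.Finite ℂ (complexBetti ((AbelianVariety.trivial k).baseChange ℂ).X 1) :=
    (Motives.abelianVarietyCohomologyExteriorH1_holds ((AbelianVariety.trivial k).baseChange ℂ)).1
  have h0 : Module.finrank ℂ (complexBetti ((AbelianVariety.trivial k).baseChange ℂ).X 1) = 0 := by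
    rw [Motives.AbelianVariety.finrank_complexBetti_one, Motives.AbelianVariety.dim_baseChange,
      Motives.AbelianVariety.dim_trivial]
  exact Module.finrank_zero_iff.1 h0

/-- **V-B22 (TRIBUNAL-B v3, row B38): the junction predicate `HasRationalInvariantForms` is
inhabited — it holds on the trivial abelian variety `0 = Spec k`** for every field `k ⊆ ℂ`.
Shimura's `𝔇₀(G; k)` has dimension `n = dim G` (§2.6 Prop. 3), here `0`: with
`H¹((0 ⊗_k ℂ)(ℂ); ℂ) = 0` (`subsingleton_complexBetti_one_trivial_baseChange`) the empty family
`ω : Fin 0 → H¹` is linearly independent, consists of `(1,0)`-classes, spans all `(1,0)`-classes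
(there is only `0`), and every `k`-endomorphism acts on it through the empty `k`-matrix.
Sanity instance only (the predicate for a general `A₀/k` is GAGA + flat base change + Dolbeault).
[cite: Shimura1998, §2.6 Prop. 3 (p. 20) and §2.8 (pp. 23, 27)] -/
theorem hasRationalInvariantForms_trivial :
    HasRationalInvariantForms (AbelianVariety.trivial k) := by
  haveI := subsingleton_complexBetti_one_trivial_baseChange k
  refine ⟨0, fun i => Fin.elim0 i, linearIndependent_empty_type, fun i => Fin.elim0 i,
    fun v _ => ?_, fun _ j => Fin.elim0 j⟩
  rw [Subsingleton.elim v 0]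
  exact Submodule.zero_mem _

end Literature.NumberTheory.ComplexMultiplication

end
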